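import Summits.QuantumFields.YangMills.Theorems.VirialFluxGapRegularityCutoff
import HarnessLib

/-!
# Route `VirialFluxGap` (YangMills): DERIVATIVES OF THE REGULARITY CUT-OFF `χ_reg` — explicit frame derivatives of the masses, locality, and the
# absolute bound `|∂_Y χ_reg| ≤ C/ρ²` (item (a) of fcl-p3 g40's memo v3 §3 for ⟨stmt-QuantumFields-24141⟩, second half)

✓`VirialFluxGapRegularityCutoff` defines the smooth partition function `regCutoff ρ` of the patching (generic resolvent chart on the `ρ`-regular
region, central charts on the `(ρ/√2)`-central core) through the regularity masses `linkMass k`, `seamMass` and fcl-p3's step ✓`deficitStep`.  The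
divergence budget of the patched field `χ_reg·X¹ + (1 − χ_reg)·X²` contains the UNSIGNED cross term `Σ_j ∂_jχ_reg·(c¹_j − c²_j)`
(✓`RegCutoff.frameD_patch`); this file controls it:

* `frameD_reTr_fst` ∕ `frameD_reTr_snd` (`∂_Y Re tr` of a coordinate `= Re tr(coordinate · Y_w)`), `massProfile_hasDerivAt`;
* ★ `frameD_linkMass` ∕ `frameD_seamMass` — `∂_Y m = −(Re tr U/2)·Re tr(U·Y_w)` EXPLICITLY; LOCALITY `frameD_linkMass_eq_zero` ∕ `frameD_seamMass_eq_zero` ∕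
  ★ `frameD_regCutoff_eq_zero`: `∂_Y χ_reg = 0` unless `Y` charges one of the three slice-0 wrap links or the seam root (only `12` of the `18L⁴+3` frame
  directions of `X_fix` see the cut-off);
* `abs_frameD_linkMass_le` ∕ `abs_frameD_seamMass_le` (`≤ 2` on ring histories for slots of Frobenius norm `≤ 1`, via ✓`abs_re_trace_su_mul_le`),
  `exists_bound_deriv_deficitStep` (`ψ′` bounded: continuous, `0` off `[½,1]`), `frameD_step_factor`, `abs_frameD_step_factor_le`;
* ★★★ `exists_bound_frameD_regCutoff` — an ABSOLUTE `C ≥ 0` with `|∂_Y χ_reg(ringCoord P)| ≤ C/ρ²` for every `L`, `ρ > 0`, ring history `P` and unit-slot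
  assignment `Y` (so with `ρ` polynomial in `L⁻¹` the cross term is polynomial, and it is multiplied by `|c¹ − c²| = O(√t₀)` near the valley).

HONEST FRAMING: plumbing (theorems only, 0 `def`, 0 `sorry`, standard axioms); the patching INEQUALITIES, the central charts and the assembly are NOT here;
⟨24141⟩ and ⟨22884⟩ stay OPEN; no stub ∕ crux ∕ rung ∕ summit is closed; the Yang–Mills mass gap is NOT proved; no summit is proved by a line.
Width seat `ym-line-sfw-p2-w2` g52 (cell ym-idea-1, free hands), `--supports stmt-QuantumFields-24141`.
References: [cite: Luscher1983, §2]; [cite: SeilerLNP1982, §2]; [cite: arXiv220412737, §2 (2.4) (p. 10)] (left-invariant derivatives); [folklore].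
-/

set_option autoImplicit false

noncomputable section

open scoped Matrix BigOperators ContDiff Topology Quaternion
open MeasureTheory
open Literature.MathematicalPhysics.QuantumFieldTheory hiding SU2
open Literature.MathematicalPhysics.QuantumLattice
open Literature.MathematicalPhysics.QuantumFieldTheory.SUNBakryEmery (expSU coe_expSU matTop)

namespace Summit.QuantumFields.YangMills.Theorems.VirialFluxGap.RegCutoff

open Summit.QuantumFields.YangMills.Theorems.FemtoTransferGap
open Summit.QuantumFields.YangMills.Theorems.FemtoTransferGap.TT
open Summit.QuantumFields.YangMills.Theorems.FemtoTransferGap.TwoLattice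
open Summit.QuantumFields.YangMills.Theorems.FemtoTransferGap.TwoLattice.Flat
open Summit.QuantumFields.YangMills.Theorems.VirialFluxGap.RingDeficit
open Summit.QuantumFields.YangMills.Theorems.VirialFluxGap.FrameDerivative
open Summit.QuantumFields.YangMills.Theorems.VirialFluxGap.FrameHessian

variable {L : ℕ} [NeZero L]

open scoped Matrix.Norms.Frobenius

attribute [local instance 2000] Literature.MathematicalPhysics.QuantumFieldTheory.SUNBakryEmery.matTop

/-! ## §5 Frame derivatives of the masses and of the cut-off: locality and the bound `|∂_Y χ_reg| ≤ C/ρ²` -/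

omit [NeZero L] in
/-- Frame derivative of the real trace of a slice coordinate: `∂_Y Re tr(M.1 i e) = Re tr(M.1 i e · Y_{(i,e)})`. [folklore] -/
theorem frameD_reTr_fst (i : Fin (2 * L - 1 + 1)) (e : Edge 3 L) (Y : ((Fin (2 * L - 1 + 1) × Edge 3 L) ⊕ Site 3 L) → Matrix (Fin 2) (Fin 2) ℂ)
    (M : (Fin (2 * L - 1 + 1) → Edge 3 L → Matrix (Fin 2) (Fin 2) ℂ) × (Site 3 L → Matrix (Fin 2) (Fin 2) ℂ)) :
    frameD Y (fun M' => ((M'.1 i e).trace).re) M = ((M.1 i e * Y (Sum.inl (i, e))).trace).re := by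
  let T : ((Fin (2 * L - 1 + 1) → Edge 3 L → Matrix (Fin 2) (Fin 2) ℂ) × (Site 3 L → Matrix (Fin 2) (Fin 2) ℂ)) →L[ℝ] ℝ :=
    (LinearMap.toContinuousLinearMap reTr).comp ((ContinuousLinearMap.proj e).comp
      ((ContinuousLinearMap.proj i).comp (ContinuousLinearMap.fst ℝ (Fin (2 * L - 1 + 1) → Edge 3 L → Matrix (Fin 2) (Fin 2) ℂ)
        (Site 3 L → Matrix (Fin 2) (Fin 2) ℂ))))
  have hT : (fun M' : ((Fin (2 * L - 1 + 1) → Edge 3 L → Matrix (Fin 2) (Fin 2) ℂ) × (Site 3 L → Matrix (Fin 2) (Fin 2) ℂ)) =>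
      ((M'.1 i e).trace).re) = ⇑T := rfl
  rw [frameD, hT, T.fderiv]
  rfl

omit [NeZero L] in
/-- Frame derivative of the real trace of a seam coordinate: `∂_Y Re tr(M.2 x) = Re tr(M.2 x · Y_x)`. [folklore] -/
theorem frameD_reTr_snd (x : Site 3 L) (Y : ((Fin (2 * L - 1 + 1) × Edge 3 L) ⊕ Site 3 L) → Matrix (Fin 2) (Fin 2) ℂ)
    (M : (Fin (2 * L - 1 + 1) → Edge 3 L → Matrix (Fin 2) (Fin 2) ℂ) × (Site 3 L → Matrix (Fin 2) (Fin 2) ℂ)) :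
    frameD Y (fun M' => ((M'.2 x).trace).re) M = ((M.2 x * Y (Sum.inr x)).trace).re := by
  let T : ((Fin (2 * L - 1 + 1) → Edge 3 L → Matrix (Fin 2) (Fin 2) ℂ) × (Site 3 L → Matrix (Fin 2) (Fin 2) ℂ)) →L[ℝ] ℝ :=
    (LinearMap.toContinuousLinearMap reTr).comp ((ContinuousLinearMap.proj x).comp
      (ContinuousLinearMap.snd ℝ (Fin (2 * L - 1 + 1) → Edge 3 L → Matrix (Fin 2) (Fin 2) ℂ) (Site 3 L → Matrix (Fin 2) (Fin 2) ℂ)))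
  have hT : (fun M' : ((Fin (2 * L - 1 + 1) → Edge 3 L → Matrix (Fin 2) (Fin 2) ℂ) × (Site 3 L → Matrix (Fin 2) (Fin 2) ℂ)) =>
      ((M'.2 x).trace).re) = ⇑T := rfl
  rw [frameD, hT, T.fderiv]
  rfl

omit [NeZero L] in
/-- The profile `t ↦ 1 − (t/2)²` of the masses has derivative `−t/2`. [folklore] -/
theorem massProfile_hasDerivAt (t : ℝ) : HasDerivAt (fun t : ℝ => 1 - (t / 2) ^ 2) (-(t / 2)) t := by
  have h1 : HasDerivAt (fun x : ℝ => x / 2) (1 / 2) t := (hasDerivAt_id t).div_const 2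
  have h2 : HasDerivAt (fun x : ℝ => x / 2 * (x / 2)) (1 / 2 * (t / 2) + t / 2 * (1 / 2)) t := h1.mul h1
  have h3 : HasDerivAt (fun x : ℝ => 1 - x / 2 * (x / 2)) (-(1 / 2 * (t / 2) + t / 2 * (1 / 2))) t := h2.const_sub 1
  have e : (fun t : ℝ => 1 - (t / 2) ^ 2) = fun x => 1 - x / 2 * (x / 2) := by funext x; ring
  have e2 : -(t / 2) = -(1 / 2 * (t / 2) + t / 2 * (1 / 2)) := by ring
  rw [e, e2]
  exact h3

omit [NeZero L] in
/-- The profile `t ↦ 1 − (t/2)²` of the masses: derivative `−t/2`. [folklore] -/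
theorem massProfile_deriv (t : ℝ) : deriv (fun t : ℝ => 1 - (t / 2) ^ 2) t = -(t / 2) :=
  (massProfile_hasDerivAt t).deriv

/-- ★ **The frame derivative of a link mass**: `∂_Y m_k(M) = −(Re tr U/2)·Re tr(U·Y_{(0,e_k)})`, `U = M.1 0 (wrapEdge k)`. [folklore] -/
theorem frameD_linkMass (k : Fin 3) (Y : ((Fin (2 * L - 1 + 1) × Edge 3 L) ⊕ Site 3 L) → Matrix (Fin 2) (Fin 2) ℂ)
    (M : (Fin (2 * L - 1 + 1) → Edge 3 L → Matrix (Fin 2) (Fin 2) ℂ) × (Site 3 L → Matrix (Fin 2) (Fin 2) ℂ)) :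
    frameD Y (linkMass k) M =
      -((((M.1 0 (wrapEdge k)).trace).re / 2) * (((M.1 0 (wrapEdge k) * Y (Sum.inl (0, wrapEdge k))).trace).re)) := by
  have hψ : ContDiff ℝ ∞ (fun t : ℝ => 1 - (t / 2) ^ 2) := contDiff_const.sub ((contDiff_id.div_const 2).pow 2)
  have hf : ContDiff ℝ ∞ (fun M' : ((Fin (2 * L - 1 + 1) → Edge 3 L → Matrix (Fin 2) (Fin 2) ℂ) × (Site 3 L → Matrix (Fin 2) (Fin 2) ℂ)) =>
      ((M'.1 0 (wrapEdge k)).trace).re) := contDiff_reTr.comp (contDiff_coord_fst 0 (wrapEdge k))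
  have h := frameD_comp_deriv hψ hf Y M
  unfold linkMass
  rw [h, massProfile_deriv, frameD_reTr_fst]
  ring

/-- ★ **The frame derivative of the seam mass**: `∂_Y m_seam(M) = −(Re tr V/2)·Re tr(V·Y_{0})`, `V = M.2 0`. [folklore] -/
theorem frameD_seamMass (Y : ((Fin (2 * L - 1 + 1) × Edge 3 L) ⊕ Site 3 L) → Matrix (Fin 2) (Fin 2) ℂ)
    (M : (Fin (2 * L - 1 + 1) → Edge 3 L → Matrix (Fin 2) (Fin 2) ℂ) × (Site 3 L → Matrix (Fin 2) (Fin 2) ℂ)) :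
    frameD Y seamMass M = -((((M.2 0).trace).re / 2) * (((M.2 0 * Y (Sum.inr 0)).trace).re)) := by
  have hψ : ContDiff ℝ ∞ (fun t : ℝ => 1 - (t / 2) ^ 2) := contDiff_const.sub ((contDiff_id.div_const 2).pow 2)
  have hf : ContDiff ℝ ∞ (fun M' : ((Fin (2 * L - 1 + 1) → Edge 3 L → Matrix (Fin 2) (Fin 2) ℂ) × (Site 3 L → Matrix (Fin 2) (Fin 2) ℂ)) =>
      ((M'.2 0).trace).re) := contDiff_reTr.comp (contDiff_coord_snd 0)
  have h := frameD_comp_deriv hψ hf Y M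
  unfold seamMass
  rw [h, massProfile_deriv, frameD_reTr_snd]
  ring

/-- LOCALITY: a link mass has zero frame derivative along every assignment vanishing at its wrap link. [folklore] -/
theorem frameD_linkMass_eq_zero (k : Fin 3) {Y : ((Fin (2 * L - 1 + 1) × Edge 3 L) ⊕ Site 3 L) → Matrix (Fin 2) (Fin 2) ℂ}
    (hY : Y (Sum.inl (0, wrapEdge k)) = 0) (M : (Fin (2 * L - 1 + 1) → Edge 3 L → Matrix (Fin 2) (Fin 2) ℂ) × (Site 3 L → Matrix (Fin 2) (Fin 2) ℂ)) :
    frameD Y (linkMass k) M = 0 := by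
  rw [frameD_linkMass, hY, Matrix.mul_zero, Matrix.trace_zero, Complex.zero_re, mul_zero, neg_zero]

/-- LOCALITY: the seam mass has zero frame derivative along every assignment vanishing at the seam root. [folklore] -/
theorem frameD_seamMass_eq_zero {Y : ((Fin (2 * L - 1 + 1) × Edge 3 L) ⊕ Site 3 L) → Matrix (Fin 2) (Fin 2) ℂ} (hY : Y (Sum.inr 0) = 0)
    (M : (Fin (2 * L - 1 + 1) → Edge 3 L → Matrix (Fin 2) (Fin 2) ℂ) × (Site 3 L → Matrix (Fin 2) (Fin 2) ℂ)) :
    frameD Y seamMass M = 0 := by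
  rw [frameD_seamMass, hY, Matrix.mul_zero, Matrix.trace_zero, Complex.zero_re, mul_zero, neg_zero]

/-- ★ **The masses have frame derivatives bounded by `2` on ring histories** (slots of Frobenius norm `≤ 1`):
`|Re tr U| ≤ 2` and `|Re tr(U·Y)| ≤ √2·‖Y‖_F` for `U ∈ SU(2)` (✓`abs_re_trace_su_mul_le`). [folklore] -/
theorem abs_frameD_linkMass_le (k : Fin 3) {Y : ((Fin (2 * L - 1 + 1) × Edge 3 L) ⊕ Site 3 L) → Matrix (Fin 2) (Fin 2) ℂ}
    (hY : ∀ w, ‖Y w‖ ≤ 1) (P : (Fin (2 * L - 1 + 1) → GaugeConfig 3 L SU2) × (Site 3 L → SU2)) :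
    |frameD Y (linkMass k) (ringCoord L P)| ≤ 2 := by
  rw [frameD_linkMass]
  have hU : (ringCoord L P).1 0 (wrapEdge k) = ((P.1 0 (wrapEdge k) : SU2) : Matrix (Fin 2) (Fin 2) ℂ) := rfl
  rw [hU]
  have h4 : |((((P.1 0 (wrapEdge k) : SU2) : Matrix (Fin 2) (Fin 2) ℂ)).trace).re / 2| ≤ 1 := by
    rw [su2_trace_re_eq_quat]
    have h1 := abs_re_su2Quat_le (P.1 0 (wrapEdge k))
    rw [abs_le] at h1 ⊢
    constructor <;> linarith [h1.1, h1.2]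
  have h2 := abs_re_trace_su_mul_le (P.1 0 (wrapEdge k)) (Y (Sum.inl (0, wrapEdge k)))
  rw [frobNorm_eq_norm] at h2
  have h3 : Real.sqrt (2 : ℕ) * ‖Y (Sum.inl (0, wrapEdge k))‖ ≤ 2 := by
    have hs : Real.sqrt (2 : ℕ) ≤ 2 := by
      rw [show ((2 : ℕ) : ℝ) = 2 by norm_num, Real.sqrt_le_left (by norm_num)]
      norm_num
    calc Real.sqrt (2 : ℕ) * ‖Y (Sum.inl (0, wrapEdge k))‖ ≤ 2 * 1 :=
          mul_le_mul hs (hY _) (norm_nonneg _) (by norm_num)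
      _ = 2 := by ring
  rw [abs_neg, abs_mul]
  calc |((((P.1 0 (wrapEdge k) : SU2) : Matrix (Fin 2) (Fin 2) ℂ)).trace).re / 2| *
        |((((P.1 0 (wrapEdge k) : SU2) : Matrix (Fin 2) (Fin 2) ℂ) * Y (Sum.inl (0, wrapEdge k))).trace).re|
      ≤ 1 * 2 := mul_le_mul h4 (h2.trans h3) (abs_nonneg _) (by norm_num)
    _ = 2 := by ring

/-- ★ The seam mass has frame derivatives bounded by `2` on ring histories. [folklore] -/
theorem abs_frameD_seamMass_le {Y : ((Fin (2 * L - 1 + 1) × Edge 3 L) ⊕ Site 3 L) → Matrix (Fin 2) (Fin 2) ℂ}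
    (hY : ∀ w, ‖Y w‖ ≤ 1) (P : (Fin (2 * L - 1 + 1) → GaugeConfig 3 L SU2) × (Site 3 L → SU2)) :
    |frameD Y seamMass (ringCoord L P)| ≤ 2 := by
  rw [frameD_seamMass]
  have hU : (ringCoord L P).2 0 = ((P.2 0 : SU2) : Matrix (Fin 2) (Fin 2) ℂ) := rfl
  rw [hU]
  have h4 : |((((P.2 0 : SU2) : Matrix (Fin 2) (Fin 2) ℂ)).trace).re / 2| ≤ 1 := by
    rw [su2_trace_re_eq_quat]
    have h1 := abs_re_su2Quat_le (P.2 0)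
    rw [abs_le] at h1 ⊢
    constructor <;> linarith [h1.1, h1.2]
  have h2 := abs_re_trace_su_mul_le (P.2 0) (Y (Sum.inr 0))
  rw [frobNorm_eq_norm] at h2
  have h3 : Real.sqrt (2 : ℕ) * ‖Y (Sum.inr 0)‖ ≤ 2 := by
    have hs : Real.sqrt (2 : ℕ) ≤ 2 := by
      rw [show ((2 : ℕ) : ℝ) = 2 by norm_num, Real.sqrt_le_left (by norm_num)]
      norm_num
    calc Real.sqrt (2 : ℕ) * ‖Y (Sum.inr 0)‖ ≤ 2 * 1 := mul_le_mul hs (hY _) (norm_nonneg _) (by norm_num)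
      _ = 2 := by ring
  rw [abs_neg, abs_mul]
  calc |((((P.2 0 : SU2) : Matrix (Fin 2) (Fin 2) ℂ)).trace).re / 2| * |((((P.2 0 : SU2) : Matrix (Fin 2) (Fin 2) ℂ) * Y (Sum.inr 0)).trace).re|
      ≤ 1 * 2 := mul_le_mul h4 (h2.trans h3) (abs_nonneg _) (by norm_num)
    _ = 2 := by ring

omit [NeZero L] in
/-- ★ `ψ′` is bounded: `∃ C ≥ 0, |deficitStep′ r| ≤ C` (continuous, and `0` off `[½,1]`). [folklore] -/
theorem exists_bound_deriv_deficitStep : ∃ C : ℝ, 0 ≤ C ∧ ∀ r : ℝ, |deriv deficitStep r| ≤ C := by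
  have hcont : Continuous (deriv deficitStep) := contDiff_deficitStep.continuous_deriv (by simp)
  obtain ⟨B, hB⟩ := isCompact_Icc.exists_bound_of_continuousOn (s := Set.Icc (0 : ℝ) 1) hcont.continuousOn
  refine ⟨max B 0, le_max_right _ _, fun r => ?_⟩
  by_cases hr : r ∈ Set.Icc (0 : ℝ) 1
  · exact ((Real.norm_eq_abs _).symm.le.trans (hB r hr)).trans (le_max_left _ _)
  · rw [Set.mem_Icc, not_and_or, not_le, not_le] at hr
    have h0 : deriv deficitStep r = 0 := by
      rcases hr with hr | hr
      · have hev : deficitStep =ᶠ[𝓝 r] fun _ => (1 : ℝ) :=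
          Filter.eventuallyEq_of_mem (Iio_mem_nhds (show r < 1 / 2 by linarith)) fun y hy => deficitStep_eq_one (le_of_lt hy)
        rw [hev.deriv_eq, deriv_const]
      · have hev : deficitStep =ᶠ[𝓝 r] fun _ => (0 : ℝ) :=
          Filter.eventuallyEq_of_mem (Ioi_mem_nhds hr) fun y hy => deficitStep_eq_zero (le_of_lt hy)
        rw [hev.deriv_eq, deriv_const]
    rw [h0, abs_zero]
    exact le_max_right _ _

/-- Frame derivative of a step factor `ψ(f/ρ²)`: `ψ′(f/ρ²)·∂_Y f/ρ²`. [folklore] -/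
theorem frameD_step_factor {f : ((Fin (2 * L - 1 + 1) → Edge 3 L → Matrix (Fin 2) (Fin 2) ℂ) × (Site 3 L → Matrix (Fin 2) (Fin 2) ℂ)) → ℝ}
    (hf : ContDiff ℝ ∞ f) (ρ : ℝ) (Y : ((Fin (2 * L - 1 + 1) × Edge 3 L) ⊕ Site 3 L) → Matrix (Fin 2) (Fin 2) ℂ)
    (M : (Fin (2 * L - 1 + 1) → Edge 3 L → Matrix (Fin 2) (Fin 2) ℂ) × (Site 3 L → Matrix (Fin 2) (Fin 2) ℂ)) :
    frameD Y (fun M' => deficitStep (f M' / ρ ^ 2)) M = deriv deficitStep (f M / ρ ^ 2) * (frameD Y f M / ρ ^ 2) := by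
  have hf' : ContDiff ℝ ∞ fun M' => f M' / ρ ^ 2 := hf.div_const _
  rw [frameD_comp_deriv contDiff_deficitStep hf']
  congr 1
  have e : (fun M' => f M' / ρ ^ 2) = fun M' => (ρ ^ 2)⁻¹ * f M' := by funext M'; ring
  rw [e, frameD, frameD]
  have hd : HasFDerivAt (fun M' => (ρ ^ 2)⁻¹ * f M') ((ρ ^ 2)⁻¹ • fderiv ℝ f M) M :=
    (((hf.differentiable (by simp)) M).hasFDerivAt).const_mul _
  rw [hd.fderiv]
  show (ρ ^ 2)⁻¹ * fderiv ℝ f M (mulTangent Y M) = fderiv ℝ f M (mulTangent Y M) / ρ ^ 2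
  ring

/-- A step factor and its frame derivative: `|ψ| ≤ 1` and `|∂_Y ψ(f/ρ²)| ≤ C_ψ·B/ρ²` when `|∂_Y f| ≤ B`. [folklore] -/
theorem abs_frameD_step_factor_le {f : ((Fin (2 * L - 1 + 1) → Edge 3 L → Matrix (Fin 2) (Fin 2) ℂ) × (Site 3 L → Matrix (Fin 2) (Fin 2) ℂ)) → ℝ}
    (hf : ContDiff ℝ ∞ f) {ρ Cψ B : ℝ} (hρ : 0 < ρ) (hCψ : ∀ r : ℝ, |deriv deficitStep r| ≤ Cψ)
    (Y : ((Fin (2 * L - 1 + 1) × Edge 3 L) ⊕ Site 3 L) → Matrix (Fin 2) (Fin 2) ℂ)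
    {M : (Fin (2 * L - 1 + 1) → Edge 3 L → Matrix (Fin 2) (Fin 2) ℂ) × (Site 3 L → Matrix (Fin 2) (Fin 2) ℂ)} (hB : |frameD Y f M| ≤ B) :
    |frameD Y (fun M' => deficitStep (f M' / ρ ^ 2)) M| ≤ Cψ * B / ρ ^ 2 := by
  rw [frameD_step_factor hf, abs_mul, abs_div, abs_of_pos (by positivity : (0 : ℝ) < ρ ^ 2), mul_div_assoc]
  have hC0 : 0 ≤ Cψ := (abs_nonneg _).trans (hCψ 0)
  exact mul_le_mul (hCψ _) (div_le_div_of_nonneg_right hB (by positivity)) (by positivity) hC0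

/-- ★★★ **THE DERIVATIVE BOUND OF THE REGULARITY CUT-OFF**: there is an absolute constant `C ≥ 0` such that for every `L`, every `ρ > 0`,
every ring history `P` and every assignment `Y` with slots of Frobenius norm `≤ 1`, `|∂_Y χ_reg(ringCoord P)| ≤ C/ρ²` (the unsigned cross term
of the patching is `O(ρ⁻²)·|c¹ − c²|`, polynomial in `L` for polynomial `ρ`). [folklore] -/
theorem exists_bound_frameD_regCutoff : ∃ C : ℝ, 0 ≤ C ∧ ∀ (L : ℕ) [NeZero L] (ρ : ℝ), 0 < ρ →
    ∀ (P : (Fin (2 * L - 1 + 1) → GaugeConfig 3 L SU2) × (Site 3 L → SU2))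
      (Y : ((Fin (2 * L - 1 + 1) × Edge 3 L) ⊕ Site 3 L) → Matrix (Fin 2) (Fin 2) ℂ), (∀ w, ‖Y w‖ ≤ 1) →
      |frameD Y (regCutoff ρ) (ringCoord L P)| ≤ C / ρ ^ 2 := by
  obtain ⟨Cψ, hCψ0, hCψ⟩ := exists_bound_deriv_deficitStep
  refine ⟨8 * Cψ, by positivity, fun L _ ρ hρ P Y hY => ?_⟩
  set M := ringCoord L P with hM
  -- the four factors and their derivatives
  have hA : ∀ k : Fin 3, ContDiff ℝ ∞ fun M' : ((Fin (2 * L - 1 + 1) → Edge 3 L → Matrix (Fin 2) (Fin 2) ℂ) × (Site 3 L → Matrix (Fin 2) (Fin 2) ℂ)) =>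
      deficitStep (linkMass k M' / ρ ^ 2) := fun k => contDiff_deficitStep.comp ((contDiff_linkMass k).div_const _)
  have hD : ContDiff ℝ ∞ fun M' : ((Fin (2 * L - 1 + 1) → Edge 3 L → Matrix (Fin 2) (Fin 2) ℂ) × (Site 3 L → Matrix (Fin 2) (Fin 2) ℂ)) =>
      deficitStep (seamMass M' / ρ ^ 2) := contDiff_deficitStep.comp (contDiff_seamMass.div_const _)
  have ha : ∀ k : Fin 3, |frameD Y (fun M' => deficitStep (linkMass k M' / ρ ^ 2)) M| ≤ Cψ * 2 / ρ ^ 2 := fun k =>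
    abs_frameD_step_factor_le (contDiff_linkMass k) hρ hCψ Y (abs_frameD_linkMass_le k hY P)
  have hd : |frameD Y (fun M' => deficitStep (seamMass M' / ρ ^ 2)) M| ≤ Cψ * 2 / ρ ^ 2 :=
    abs_frameD_step_factor_le contDiff_seamMass hρ hCψ Y (abs_frameD_seamMass_le hY P)
  -- expand the derivative of the product by the product rule
  have hprod : frameD Y (regCutoff ρ) M =
      -((deficitStep (linkMass 0 M / ρ ^ 2) * deficitStep (linkMass 1 M / ρ ^ 2) * deficitStep (linkMass 2 M / ρ ^ 2)) *
          frameD Y (fun M' => deficitStep (seamMass M' / ρ ^ 2)) M +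
        deficitStep (seamMass M / ρ ^ 2) *
          ((deficitStep (linkMass 0 M / ρ ^ 2) * deficitStep (linkMass 1 M / ρ ^ 2)) * frameD Y (fun M' => deficitStep (linkMass 2 M' / ρ ^ 2)) M +
            deficitStep (linkMass 2 M / ρ ^ 2) *
              (deficitStep (linkMass 0 M / ρ ^ 2) * frameD Y (fun M' => deficitStep (linkMass 1 M' / ρ ^ 2)) M +
                deficitStep (linkMass 1 M / ρ ^ 2) * frameD Y (fun M' => deficitStep (linkMass 0 M' / ρ ^ 2)) M))) := by
    unfold regCutoff
    rw [frameD_one_sub, frameD_mul (((hA 0).mul (hA 1)).mul (hA 2)) hD, frameD_mul ((hA 0).mul (hA 1)) (hA 2), frameD_mul (hA 0) (hA 1)]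
  rw [hprod, abs_neg]
  -- bound term by term, each step factor in `[0,1]`
  set a0 := deficitStep (linkMass 0 M / ρ ^ 2) with ha0d
  set a1 := deficitStep (linkMass 1 M / ρ ^ 2) with ha1d
  set a2 := deficitStep (linkMass 2 M / ρ ^ 2) with ha2d
  set a3 := deficitStep (seamMass M / ρ ^ 2) with ha3d
  set d0 := frameD Y (fun M' => deficitStep (linkMass 0 M' / ρ ^ 2)) M
  set d1 := frameD Y (fun M' => deficitStep (linkMass 1 M' / ρ ^ 2)) M
  set d2 := frameD Y (fun M' => deficitStep (linkMass 2 M' / ρ ^ 2)) M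
  set d3 := frameD Y (fun M' => deficitStep (seamMass M' / ρ ^ 2)) M
  have ha0 : 0 ≤ a0 ∧ a0 ≤ 1 := ⟨deficitStep_nonneg _, deficitStep_le_one _⟩
  have ha1 : 0 ≤ a1 ∧ a1 ≤ 1 := ⟨deficitStep_nonneg _, deficitStep_le_one _⟩
  have ha2 : 0 ≤ a2 ∧ a2 ≤ 1 := ⟨deficitStep_nonneg _, deficitStep_le_one _⟩
  have ha3 : 0 ≤ a3 ∧ a3 ≤ 1 := ⟨deficitStep_nonneg _, deficitStep_le_one _⟩
  have key : ∀ c d : ℝ, 0 ≤ c → c ≤ 1 → |d| ≤ Cψ * 2 / ρ ^ 2 → |c * d| ≤ Cψ * 2 / ρ ^ 2 := fun c d hc hc1 hdd => by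
    rw [abs_mul, abs_of_nonneg hc]
    calc c * |d| ≤ 1 * (Cψ * 2 / ρ ^ 2) := mul_le_mul hc1 hdd (abs_nonneg _) zero_le_one
      _ = Cψ * 2 / ρ ^ 2 := one_mul _
  have t3 := key (a0 * a1 * a2) d3 (mul_nonneg (mul_nonneg ha0.1 ha1.1) ha2.1) (mul_le_one₀ (mul_le_one₀ ha0.2 ha1.1 ha1.2) ha2.1 ha2.2) hd
  have t2 := key (a3 * a0 * a1) d2 (mul_nonneg (mul_nonneg ha3.1 ha0.1) ha1.1) (mul_le_one₀ (mul_le_one₀ ha3.2 ha0.1 ha0.2) ha1.1 ha1.2) (ha 2)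
  have t1 := key (a3 * a2 * a0) d1 (mul_nonneg (mul_nonneg ha3.1 ha2.1) ha0.1) (mul_le_one₀ (mul_le_one₀ ha3.2 ha2.1 ha2.2) ha0.1 ha0.2) (ha 1)
  have t0 := key (a3 * a2 * a1) d0 (mul_nonneg (mul_nonneg ha3.1 ha2.1) ha1.1) (mul_le_one₀ (mul_le_one₀ ha3.2 ha2.1 ha2.2) ha1.1 ha1.2) (ha 0)
  have e : a0 * a1 * a2 * d3 + a3 * (a0 * a1 * d2 + a2 * (a0 * d1 + a1 * d0)) =
      a0 * a1 * a2 * d3 + a3 * a0 * a1 * d2 + a3 * a2 * a0 * d1 + a3 * a2 * a1 * d0 := by ring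
  rw [e]
  have tri : |a0 * a1 * a2 * d3 + a3 * a0 * a1 * d2 + a3 * a2 * a0 * d1 + a3 * a2 * a1 * d0| ≤
      |a0 * a1 * a2 * d3| + |a3 * a0 * a1 * d2| + |a3 * a2 * a0 * d1| + |a3 * a2 * a1 * d0| := by
    have h1 := abs_add_le (a0 * a1 * a2 * d3 + a3 * a0 * a1 * d2 + a3 * a2 * a0 * d1) (a3 * a2 * a1 * d0)
    have h2 := abs_add_le (a0 * a1 * a2 * d3 + a3 * a0 * a1 * d2) (a3 * a2 * a0 * d1)
    have h3 := abs_add_le (a0 * a1 * a2 * d3) (a3 * a0 * a1 * d2)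
    linarith
  have e8 : 8 * Cψ / ρ ^ 2 = 4 * (Cψ * 2 / ρ ^ 2) := by ring
  rw [e8]
  linarith [tri, t0, t1, t2, t3]

/-- ★ **LOCALITY of the cut-off**: `∂_Y χ_reg = 0` along every assignment vanishing at the three slice-0 wrap links and at the seam root —
only `12` frame directions of `X_fix` see `χ_reg`. [folklore] -/
theorem frameD_regCutoff_eq_zero (ρ : ℝ) {Y : ((Fin (2 * L - 1 + 1) × Edge 3 L) ⊕ Site 3 L) → Matrix (Fin 2) (Fin 2) ℂ}
    (hk : ∀ k : Fin 3, Y (Sum.inl (0, wrapEdge k)) = 0) (hs : Y (Sum.inr 0) = 0)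
    (M : (Fin (2 * L - 1 + 1) → Edge 3 L → Matrix (Fin 2) (Fin 2) ℂ) × (Site 3 L → Matrix (Fin 2) (Fin 2) ℂ)) :
    frameD Y (regCutoff ρ) M = 0 := by
  have hA : ∀ k : Fin 3, ContDiff ℝ ∞ fun M' : ((Fin (2 * L - 1 + 1) → Edge 3 L → Matrix (Fin 2) (Fin 2) ℂ) × (Site 3 L → Matrix (Fin 2) (Fin 2) ℂ)) =>
      deficitStep (linkMass k M' / ρ ^ 2) := fun k => contDiff_deficitStep.comp ((contDiff_linkMass k).div_const _)
  have hD : ContDiff ℝ ∞ fun M' : ((Fin (2 * L - 1 + 1) → Edge 3 L → Matrix (Fin 2) (Fin 2) ℂ) × (Site 3 L → Matrix (Fin 2) (Fin 2) ℂ)) =>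
      deficitStep (seamMass M' / ρ ^ 2) := contDiff_deficitStep.comp (contDiff_seamMass.div_const _)
  have ha : ∀ k : Fin 3, frameD Y (fun M' => deficitStep (linkMass k M' / ρ ^ 2)) M = 0 := fun k => by
    rw [frameD_step_factor (contDiff_linkMass k), frameD_linkMass_eq_zero k (hk k), zero_div, mul_zero]
  have hd : frameD Y (fun M' => deficitStep (seamMass M' / ρ ^ 2)) M = 0 := by
    rw [frameD_step_factor contDiff_seamMass, frameD_seamMass_eq_zero hs, zero_div, mul_zero]
  unfold regCutoff
  rw [frameD_one_sub, frameD_mul (((hA 0).mul (hA 1)).mul (hA 2)) hD, frameD_mul ((hA 0).mul (hA 1)) (hA 2), frameD_mul (hA 0) (hA 1),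
    ha 0, ha 1, ha 2, hd]
  ring

end Summit.QuantumFields.YangMills.Theorems.VirialFluxGap.RegCutoff

end
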